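import Summits.CriticalPhenomena.PercolationContinuityZ3.Theses.PercNonProliferation
import Summits.CriticalPhenomena.PercolationContinuityZ3.Theorems.NonProliferation.Negative.AboveSix
import Literature.Barriers.CriticalPhenomena.SpanningClustersAboveSix
import Literature.Probability.Percolation.RussoFormula
import HarnessLib

/-!
# Crux `PercNonProliferation.NonProliferation` (stmt-CriticalPhenomena-4444), line `birth-merge-ledger` — stub `stub_typeTable`

Helper file for the lead's skeleton of line `birth-merge-ledger`
(`Cruxes/NonProliferation/Lines/birth_merge_ledger.lean`, prover-line-stmt-CriticalPhenomena-4444-0).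
Proves exactly the registered stub signature `stub_typeTable`; lands with `--supports stmt-CriticalPhenomena-4444`.

The stub is the combinatorial birth–merge type table of the monotone coupling: for an edge
`e = s(x, y)` of `B(2n)`, `Σ_{k < #B(n)} (1[ω⁺ ∈ repEvent k] - 1[ω⁻ ∈ repEvent k]) = 1[birth_e] - 1[merge_e]`
(`ω⁺ = insert e ω`, `ω⁻ = ω \ {e}`).  Argument: for a symmetric transitive relation given by its
class map `C : V → Set V` (here `v ∈ C u ↔ u ↔ v in B(2n)`), let `S` be the set of classes of points
of `P = B(n)` meeting `Q = ∂ⁱⁿB(2n)` (spanning clusters); then `η ∈ repEvent d k n ↔ k + 1 ≤ #S` and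
`#S ≤ #B(n)` (`succ_le_ncard_SC_iff`, `ncard_SC_le`), so the layer-cake sum is `#S`
(`sum_indicator_repEvent`).  Opening `e` replaces `C` by the glued class map `C'`
(`v ∈ C' u ↔ v ∈ C u ∨ (x ∈ C u ∧ v ∈ C y) ∨ (y ∈ C u ∧ v ∈ C x)`: a walk avoids `e` or uses it,
`conn_insert_iff`); comparing `S \ {C x, C y}` with `S' \ {C x ∪ C y}` (`SC_diff_eq`) gives
`#S' + 1[C x ∈ S] + 1[C y ∈ S] = #S + 1[C x ∪ C y ∈ S']`, and a sixteen-case table (`table`) turns this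
into `1[birth] - 1[merge]`.  All auxiliary objects enter through characterising hypotheses (no
definitions); indicators are classical `if`s with `Classical.propDecidable` pinned.  No published
fact is used.
-/

noncomputable section

namespace Summit.CriticalPhenomena.PercolationContinuityZ3.Theorems.NonProliferation

open Literature.Probability.LatticeModels Literature.Probability.Percolation
open Summit.CriticalPhenomena.PercolationContinuityZ3.Theorems.NonProliferation.Negative

namespace StubTypeTable

variable {V : Type*}

/-- `#(s ∩ {a}) = 1[a ∈ s]`. -/
theorem ncard_inter_singleton (s : Set V) (a : V) :
    (s ∩ {a}).ncard = @ite ℕ (a ∈ s) (Classical.propDecidable _) 1 0 := by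
  by_cases h : a ∈ s
  · rw [if_pos h, Set.inter_eq_right.2 (Set.singleton_subset_iff.2 h), Set.ncard_singleton]
  · rw [if_neg h, Set.inter_singleton_eq_empty.2 h, Set.ncard_empty]

/-- `#(s ∩ {a, b}) = 1[a ∈ s] + 1[b ∈ s]` for `a ≠ b`. -/
theorem ncard_inter_pair (s : Set V) {a b : V} (hab : a ≠ b) : (s ∩ {a, b}).ncard =
    @ite ℕ (a ∈ s) (Classical.propDecidable _) 1 0 + @ite ℕ (b ∈ s) (Classical.propDecidable _) 1 0 := by
  rw [Set.insert_eq, Set.inter_union_distrib_left, Set.ncard_union_eq ?_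
    ((Set.finite_singleton a).inter_of_right s) ((Set.finite_singleton b).inter_of_right s),
    ncard_inter_singleton, ncard_inter_singleton]
  exact Set.disjoint_left.2 fun z hz hz' =>
    hab ((Set.mem_singleton_iff.1 hz.2).symm.trans (Set.mem_singleton_iff.1 hz'.2))

/-- The sixteen-case type table, as a propositional identity: if
`N' + 1[a ∧ b] + 1[c ∧ d] = N + 1[(a ∨ c) ∧ (b ∨ d)]` then `N' - N = 1[birth] - 1[merge]`. -/
theorem table {a b c d na nb nc nd r r' : Prop} {N N' : ℕ} (hr : ¬ r) (hr' : ¬ r')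
    (hna : na ↔ ¬ a) (hnb : nb ↔ ¬ b) (hnc : nc ↔ ¬ c) (hnd : nd ↔ ¬ d)
    (h : N' + (@ite ℕ (a ∧ b) (Classical.propDecidable _) 1 0 +
      @ite ℕ (c ∧ d) (Classical.propDecidable _) 1 0) =
      N + @ite ℕ ((a ∨ c) ∧ (b ∨ d)) (Classical.propDecidable _) 1 0) :
    ((N' : ℝ) - N) =
      @ite ℝ ((a ∧ nb ∧ d ∧ nc) ∨ (c ∧ nd ∧ b ∧ na)) (Classical.propDecidable _) 1 0 -
        @ite ℝ ((¬ r ∧ a ∧ b ∧ c ∧ d) ∨ (¬ r' ∧ c ∧ d ∧ a ∧ b)) (Classical.propDecidable _) 1 0 := by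
  have cast_key : ∀ {p q : Prop}, ((N' : ℤ) - N = @ite ℤ p (Classical.propDecidable _) 1 0 -
      @ite ℤ q (Classical.propDecidable _) 1 0) → ((N' : ℝ) - N =
      @ite ℝ p (Classical.propDecidable _) 1 0 - @ite ℝ q (Classical.propDecidable _) 1 0) :=
    fun h => by have h' := congrArg (Int.cast : ℤ → ℝ) h; push_cast at h'; exact h'
  refine cast_key ?_
  by_cases ha : a <;> by_cases hb : b <;> by_cases hc : c <;> by_cases hd : d <;>
    simp [ha, hb, hc, hd, hr, hr', hna, hnb, hnc, hnd] at h ⊢ <;> omega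

section ClassMap

variable {C : V → Set V} {P Q : Set V} {S : Set (Set V)}
  (hS : ∀ A, A ∈ S ↔ ∃ u ∈ P, (∃ w ∈ Q, w ∈ C u) ∧ A = C u)
include hS

/-- Spanning classes are classes of points of `P`. -/
theorem SC_subset_image : S ⊆ C '' P := fun A hA => by
  obtain ⟨u, hu, -, rfl⟩ := (hS A).1 hA
  exact ⟨u, hu, rfl⟩

/-- For finite `P` there are finitely many spanning classes. -/
theorem SC_finite (hP : P.Finite) : S.Finite := (hP.image _).subset (SC_subset_image hS)

/-- There are at most `#P` spanning classes. -/
theorem ncard_SC_le (hP : P.Finite) : S.ncard ≤ P.ncard :=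
  (Set.ncard_le_ncard (SC_subset_image hS) (hP.image _)).trans (Set.ncard_image_le hP)

variable (hs : ∀ ⦃u v⦄, v ∈ C u → u ∈ C v) (ht : ∀ ⦃u v w⦄, v ∈ C u → w ∈ C v → w ∈ C u)
include hs ht

omit hS in
/-- Related points have equal classes. -/
theorem cl_eq_of_mem {u v : V} (h : v ∈ C u) : C u = C v :=
  Set.ext fun _ => ⟨fun hw => ht (hs h) hw, fun hw => ht h hw⟩

/-- The class of `x` is spanning iff it meets `P` and `Q`. -/
theorem cl_mem_SC_iff {x : V} : C x ∈ S ↔ (∃ v ∈ P, v ∈ C x) ∧ ∃ w ∈ Q, w ∈ C x := by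
  rw [hS]
  constructor
  · rintro ⟨u, hu, ⟨w, hw, huw⟩, hEq⟩
    have huu : u ∈ C u := ht huw (hs huw)
    rw [← hEq] at huu
    exact ⟨⟨u, hu, huu⟩, w, hw, ht huu huw⟩
  · rintro ⟨⟨v, hv, hxv⟩, w, hw, hxw⟩
    exact ⟨v, hv, ⟨w, hw, ht (hs hxv) hxw⟩, cl_eq_of_mem hs ht hxv⟩

/-- `k + 1 ≤ #S` iff there are `k + 1` points of `P`, each of whose classes meets `Q`, pairwise
unrelated (the shape of `repEvent`). -/
theorem succ_le_ncard_SC_iff (hP : P.Finite) (k : ℕ) :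
    k + 1 ≤ S.ncard ↔ ∃ xs : Fin (k + 1) → V, (∀ i, xs i ∈ P) ∧
      (∀ i, ∃ w ∈ Q, w ∈ C (xs i)) ∧ ∀ i j, i ≠ j → xs j ∉ C (xs i) := by
  have hfin := SC_finite hS hP
  constructor
  · intro hk
    rw [Set.ncard_eq_toFinset_card _ hfin] at hk
    obtain ⟨f, hf⟩ := Function.Embedding.exists_of_card_le_finset (α := Fin (k + 1))
      (s := hfin.toFinset) (by rwa [Fintype.card_fin])
    have hmem : ∀ i, ∃ u ∈ P, (∃ w ∈ Q, w ∈ C u) ∧ f i = C u := fun i =>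
      (hS _).1 (hfin.mem_toFinset.1 (hf ⟨i, rfl⟩))
    choose u hu hw hEq using hmem
    refine ⟨u, hu, hw, fun i j hij hR => hij (f.injective ?_)⟩
    rw [hEq i, hEq j]
    exact cl_eq_of_mem hs ht hR
  · rintro ⟨xs, hxP, hxQ, hsep⟩
    have hinj : Set.InjOn (fun i => C (xs i)) Set.univ := fun i _ j _ hij => by
      by_contra hne
      refine hsep i j hne ?_
      obtain ⟨w, -, h⟩ := hxQ j
      have hj : xs j ∈ C (xs j) := ht h (hs h)
      rwa [← show C (xs i) = C (xs j) from hij] at hj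
    have := Set.ncard_le_ncard_of_injOn (t := S) _
      (fun i _ => (hS _).2 ⟨xs i, hxP i, hxQ i, rfl⟩) hinj hfin
    rwa [Set.ncard_univ, Nat.card_eq_fintype_card, Fintype.card_fin] at this

variable {x y : V} {C' : V → Set V}
  (hC' : ∀ u v, v ∈ C' u ↔ v ∈ C u ∨ (x ∈ C u ∧ v ∈ C y) ∨ (y ∈ C u ∧ v ∈ C x))
include hC'

omit hS ht in
/-- The glued relation is symmetric. -/
theorem glue_symm : ∀ ⦃u v⦄, v ∈ C' u → u ∈ C' v := fun u v h => by
  rw [hC'] at h ⊢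
  rcases h with h | ⟨h1, h2⟩ | ⟨h1, h2⟩
  exacts [Or.inl (hs h), Or.inr (Or.inr ⟨hs h2, hs h1⟩), Or.inr (Or.inl ⟨hs h2, hs h1⟩)]

omit hS hs in
/-- The glued relation is transitive. -/
theorem glue_trans : ∀ ⦃u v w⦄, v ∈ C' u → w ∈ C' v → w ∈ C' u := fun u v w h h' => by
  rw [hC'] at h h' ⊢
  rcases h with h | ⟨h1, h2⟩ | ⟨h1, h2⟩ <;> rcases h' with h' | ⟨h1', h2'⟩ | ⟨h1', h2'⟩
  exacts [Or.inl (ht h h'), Or.inr (Or.inl ⟨ht h h1', h2'⟩), Or.inr (Or.inr ⟨ht h h1', h2'⟩),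
    Or.inr (Or.inl ⟨h1, ht h2 h'⟩), Or.inr (Or.inl ⟨h1, h2'⟩), Or.inl (ht h1 h2'),
    Or.inr (Or.inr ⟨h1, ht h2 h'⟩), Or.inl (ht h1 h2'), Or.inr (Or.inr ⟨h1, h2'⟩)]

omit hS in
/-- If `x` and `y` are already related, gluing does nothing. -/
theorem glue_eq_of_mem (hxy : y ∈ C x) : C' = C := by
  funext u
  ext v
  rw [hC']
  refine ⟨?_, Or.inl⟩
  rintro (h | ⟨h1, h2⟩ | ⟨h1, h2⟩)
  exacts [h, ht (ht h1 hxy) h2, ht (ht h1 (hs hxy)) h2]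

omit hS hs ht in
/-- Classes away from `x` and `y` are unchanged by gluing. -/
theorem glue_cl_of_notMem {u : V} (hux : x ∉ C u) (huy : y ∉ C u) : C' u = C u := by
  ext v
  rw [hC']
  refine ⟨?_, Or.inl⟩
  rintro (h | ⟨h1, -⟩ | ⟨h1, -⟩)
  exacts [h, (hux h1).elim, (huy h1).elim]

omit hS in
/-- The glued class of a point related to `x` or to `y` is `C x ∪ C y`. -/
theorem glue_cl_of_mem {u : V} (hu : x ∈ C u ∨ y ∈ C u) : C' u = C x ∪ C y := by
  ext v
  rw [hC']
  constructor
  · rintro (h | ⟨-, h2⟩ | ⟨-, h2⟩)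
    · rcases hu with hu | hu
      exacts [Or.inl (ht (hs hu) h), Or.inr (ht (hs hu) h)]
    exacts [Or.inr h2, Or.inl h2]
  · rcases hu with hu | hu <;> rintro (h | h)
    exacts [Or.inl (ht hu h), Or.inr (Or.inl ⟨hu, h⟩), Or.inr (Or.inr ⟨hu, h⟩), Or.inl (ht hu h)]

variable {S' : Set (Set V)} (hS' : ∀ A, A ∈ S' ↔ ∃ u ∈ P, (∃ w ∈ Q, w ∈ C' u) ∧ A = C' u)
include hS'

/-- The spanning classes other than `C x`, `C y` are exactly the glued spanning classes other
than `C x ∪ C y`. -/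
theorem SC_diff_eq : S \ {C x, C y} = S' \ {C x ∪ C y} := by
  ext A
  simp only [Set.mem_sdiff, Set.mem_insert_iff, Set.mem_singleton_iff, not_or, hS, hS']
  constructor
  · rintro ⟨⟨u, hu, ⟨w, hw, huw⟩, rfl⟩, hx, hy⟩
    have hux : x ∉ C u := fun h => hx (cl_eq_of_mem hs ht h)
    have huy : y ∉ C u := fun h => hy (cl_eq_of_mem hs ht h)
    refine ⟨⟨u, hu, ⟨w, hw, (hC' u w).2 (Or.inl huw)⟩, (glue_cl_of_notMem hC' hux huy).symm⟩,
      fun hEq => ?_⟩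
    have huu : u ∈ C u := ht huw (hs huw)
    rw [hEq] at huu
    rcases huu with h | h
    exacts [hux (hs h), huy (hs h)]
  · rintro ⟨⟨u, hu, ⟨w, hw, huw⟩, rfl⟩, hxy⟩
    have hux : x ∉ C u := fun h => hxy (glue_cl_of_mem hs ht hC' (Or.inl h))
    have huy : y ∉ C u := fun h => hxy (glue_cl_of_mem hs ht hC' (Or.inr h))
    have huw' : w ∈ C u := by
      rcases (hC' u w).1 huw with h | ⟨h, -⟩ | ⟨h, -⟩
      exacts [h, (hux h).elim, (huy h).elim]
    rw [glue_cl_of_notMem hC' hux huy]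
    have huu : u ∈ C u := ht huw' (hs huw')
    refine ⟨⟨u, hu, ⟨w, hw, huw'⟩, rfl⟩, fun h => hux ?_, fun h => huy ?_⟩
    · rw [h] at huu; exact hs huu
    · rw [h] at huu; exact hs huu

/-- Counting: `#S' + 1[C x ∈ S] + 1[C y ∈ S] = #S + 1[C x ∪ C y ∈ S']` when `x` is in the domain
and `x`, `y` are unrelated (memberships spelled out via `cl_mem_SC_iff`). -/
theorem ncard_SC_glue (hP : P.Finite) (hxx : x ∈ C x) (hxy : y ∉ C x) :
    S'.ncard + (@ite ℕ ((∃ v ∈ P, v ∈ C x) ∧ ∃ w ∈ Q, w ∈ C x) (Classical.propDecidable _) 1 0 +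
        @ite ℕ ((∃ v ∈ P, v ∈ C y) ∧ ∃ w ∈ Q, w ∈ C y) (Classical.propDecidable _) 1 0) =
      S.ncard + @ite ℕ (((∃ v ∈ P, v ∈ C x) ∨ ∃ v ∈ P, v ∈ C y) ∧
        ((∃ w ∈ Q, w ∈ C x) ∨ ∃ w ∈ Q, w ∈ C y)) (Classical.propDecidable _) 1 0 := by
  have h1 := Set.ncard_inter_add_ncard_sdiff_eq_ncard S {C x, C y} (SC_finite hS hP)
  have h2 := Set.ncard_inter_add_ncard_sdiff_eq_ncard S' {C x ∪ C y} (SC_finite hS' hP)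
  have h3 := congrArg Set.ncard (SC_diff_eq hS hs ht hC' hS')
  have hne : C x ≠ C y := fun h => hxy (hs (show x ∈ C y by rw [← h]; exact hxx))
  rw [ncard_inter_pair _ hne, cl_mem_SC_iff hS hs ht, cl_mem_SC_iff hS hs ht] at h1
  have hg : ∀ T : Set V, (∃ v ∈ T, v ∈ C' x) ↔ (∃ v ∈ T, v ∈ C x) ∨ ∃ v ∈ T, v ∈ C y :=
    fun T => by
      have hv : ∀ v, v ∈ C' x ↔ v ∈ C x ∨ v ∈ C y := fun v => by
        rw [hC']
        exact ⟨by rintro (h | ⟨-, h⟩ | ⟨-, h⟩); exacts [Or.inl h, Or.inr h, Or.inl h],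
          by rintro (h | h); exacts [Or.inl h, Or.inr (Or.inl ⟨hxx, h⟩)]⟩
      simp only [hv, and_or_left, exists_or]
  have hU : C x ∪ C y ∈ S' ↔ ((∃ v ∈ P, v ∈ C x) ∨ ∃ v ∈ P, v ∈ C y) ∧
      ((∃ w ∈ Q, w ∈ C x) ∨ ∃ w ∈ Q, w ∈ C y) := by
    rw [← glue_cl_of_mem hs ht hC' (Or.inl hxx),
      cl_mem_SC_iff hS' (glue_symm hs hC') (glue_trans ht hC'), hg P, hg Q]
  rw [ncard_inter_singleton, hU] at h2
  omega

/-- The type table for an abstract class map: `#S' - #S = 1[birth] - 1[merge]`, with both events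
written as in the registered stub (existential over the orientation of `s(x, y)`). -/
theorem ncard_SC_glue_sub (hP : P.Finite) (hxx : x ∈ C x) : ((S'.ncard : ℝ) - S.ncard) =
    @ite ℝ (∃ a b, s(x, y) = s(a, b) ∧ (∃ v ∈ P, v ∈ C a) ∧ (∀ w ∈ Q, w ∉ C a) ∧
        (∃ w ∈ Q, w ∈ C b) ∧ ∀ v ∈ P, v ∉ C b) (Classical.propDecidable _) 1 0 -
      @ite ℝ (∃ a b, s(x, y) = s(a, b) ∧ b ∉ C a ∧ (∃ v ∈ P, v ∈ C a) ∧ (∃ w ∈ Q, w ∈ C a) ∧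
        (∃ v ∈ P, v ∈ C b) ∧ ∃ w ∈ Q, w ∈ C b) (Classical.propDecidable _) 1 0 := by
  have key : ∀ Φ : V → V → Prop, (∃ a b, s(x, y) = s(a, b) ∧ Φ a b) ↔ Φ x y ∨ Φ y x := fun Φ =>
    ⟨by rintro ⟨a, b, h, hΦ⟩; rcases Sym2.eq_iff.1 h with ⟨rfl, rfl⟩ | ⟨rfl, rfl⟩; exacts [Or.inl hΦ, Or.inr hΦ],
      by rintro (h | h); exacts [⟨x, y, rfl, h⟩, ⟨y, x, Sym2.eq_swap, h⟩]⟩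
  rw [key (fun a b => (∃ v ∈ P, v ∈ C a) ∧ (∀ w ∈ Q, w ∉ C a) ∧ (∃ w ∈ Q, w ∈ C b) ∧
      ∀ v ∈ P, v ∉ C b),
    key (fun a b => b ∉ C a ∧ (∃ v ∈ P, v ∈ C a) ∧ (∃ w ∈ Q, w ∈ C a) ∧ (∃ v ∈ P, v ∈ C b) ∧
      ∃ w ∈ Q, w ∈ C b)]
  by_cases hxy : y ∈ C x
  · rw [glue_eq_of_mem hs ht hC' hxy] at hS'
    rw [show S' = S from Set.ext fun A => by rw [hS, hS'], sub_self, if_neg, if_neg, sub_self]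
    · rintro (⟨h, -⟩ | ⟨h, -⟩)
      exacts [h hxy, h (hs hxy)]
    · rintro (⟨⟨v, hv, hxv⟩, -, -, hy'⟩ | ⟨⟨v, hv, hyv⟩, -, -, hx'⟩)
      exacts [hy' v hv (ht (hs hxy) hxv), hx' v hv (ht hxy hyv)]
  · exact table hxy (fun h => hxy (hs h)) (by simp) (by simp) (by simp) (by simp)
      (ncard_SC_glue hS hs ht hC' hS' hP hxx hxy)

end ClassMap

/-- `{· ↔ · in S}` is symmetric. -/
theorem conn_symm (S : Set V) (η : BondConfig V) :
    ∀ ⦃u v : V⦄, η ∈ openConnIn S u v → η ∈ openConnIn S v u := fun u v h => by rwa [openConnIn_comm]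

/-- `{· ↔ · in S}` is transitive. -/
theorem conn_trans (S : Set V) (η : BondConfig V) :
    ∀ ⦃u v w : V⦄, η ∈ openConnIn S u v → η ∈ openConnIn S v w → η ∈ openConnIn S u w :=
  fun _ _ _ h h' => PlanarDuality.openConnIn_trans h h'

/-- Opening the edge `e = s(x, y)` of `S` glues the classes of `x` and `y`:
`{u ↔ v in S}(insert e ω)` iff, in `ω \ {e}`, `u ↔ v` or `u ↔ x, y ↔ v` or `u ↔ y, x ↔ v`
(a walk of the opened graph either avoids `e` or passes through it). -/
theorem conn_insert_iff {ω : BondConfig V} {S : Set V} {e : Sym2 V} {x y : V}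
    (he : e = s(x, y)) (hne : x ≠ y) (hx : x ∈ S) (hy : y ∈ S) (u v : V) :
    insert e ω ∈ openConnIn S u v ↔ ω \ {e} ∈ openConnIn S u v ∨
      (ω \ {e} ∈ openConnIn S u x ∧ ω \ {e} ∈ openConnIn S y v) ∨
      (ω \ {e} ∈ openConnIn S u y ∧ ω \ {e} ∈ openConnIn S x v) := by
  subst he
  -- transitivity of the glued relation (`glue_trans` with the connection class maps)
  have hT := glue_trans (C := fun u => {v | ω \ {s(x, y)} ∈ openConnIn S u v})
    (C' := fun u => {v | ω \ {s(x, y)} ∈ openConnIn S u v ∨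
      (ω \ {s(x, y)} ∈ openConnIn S u x ∧ ω \ {s(x, y)} ∈ openConnIn S y v) ∨
      (ω \ {s(x, y)} ∈ openConnIn S u y ∧ ω \ {s(x, y)} ∈ openConnIn S x v)})
    (x := x) (y := y) (conn_trans S _) (fun _ _ => Iff.rfl)
  have walk : ∀ {a b : S} (p : ((openGraph (insert s(x, y) ω)).induce S).Walk a b),
      ω \ {s(x, y)} ∈ openConnIn S a.1 b.1 ∨
        (ω \ {s(x, y)} ∈ openConnIn S a.1 x ∧ ω \ {s(x, y)} ∈ openConnIn S y b.1) ∨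
        (ω \ {s(x, y)} ∈ openConnIn S a.1 y ∧ ω \ {s(x, y)} ∈ openConnIn S x b.1) := by
    intro a b p
    induction p with
    | nil => exact Or.inl (openConnIn_refl (Subtype.prop _))
    | @cons c w _ h _ ih =>
      rw [SimpleGraph.induce_adj, openGraph_adj] at h
      refine hT ?_ ih
      by_cases heq : s(c.1, w.1) = s(x, y)
      · rcases Sym2.eq_iff.1 heq with ⟨h1, h2⟩ | ⟨h1, h2⟩ <;> rw [h1, h2]
        exacts [Or.inr (Or.inl ⟨openConnIn_refl hx, openConnIn_refl hy⟩),
          Or.inr (Or.inr ⟨openConnIn_refl hy, openConnIn_refl hx⟩)]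
      · exact Or.inl (openConnIn_of_adj c.2 w.2 ⟨(Set.mem_insert_iff.1 h.1).resolve_left heq,
          fun h' => heq (Set.mem_singleton_iff.1 h')⟩ h.2)
  refine ⟨fun ⟨_, _, ⟨p⟩⟩ => walk p, ?_⟩
  have hmono : ∀ u v, ω \ {s(x, y)} ∈ openConnIn S u v → insert s(x, y) ω ∈ openConnIn S u v :=
    fun u v h => isUpperSet_openConnIn S u v (show ω \ {s(x, y)} ⊆ insert s(x, y) ω from
      Set.sdiff_subset.trans (Set.subset_insert _ ω)) h
  have hxy : insert s(x, y) ω ∈ openConnIn S x y := openConnIn_of_adj hx hy (Set.mem_insert _ _) hne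
  rintro (h | ⟨h1, h2⟩ | ⟨h1, h2⟩)
  · exact hmono _ _ h
  · exact conn_trans S _ (conn_trans S _ (hmono _ _ h1) hxy) (hmono _ _ h2)
  · exact conn_trans S _ (conn_trans S _ (hmono _ _ h1) (conn_symm S _ hxy)) (hmono _ _ h2)

/-- The set `S` of spanning classes of `{· ↔ · in B(2n)}(η)` relative to `(B(n), ∂ⁱⁿB(2n))`
exists (it enters all statements through this characterisation). -/
theorem exists_SC (d n : ℕ) (η : BondConfig (Site d)) :
    ∃ S : Set (Set (Site d)), ∀ A, A ∈ S ↔ ∃ u ∈ (↑(box d n) : Set (Site d)),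
      (∃ w ∈ (↑(innerBoundary (zdGraph d) (box d (2 * n))) : Set (Site d)),
        η ∈ openConnIn (↑(box d (2 * n)) : Set (Site d)) u w) ∧
      A = {v | η ∈ openConnIn (↑(box d (2 * n)) : Set (Site d)) u v} :=
  ⟨_, fun _ => Iff.rfl⟩

/-- `Σ_{k < #B(n)} 1[η ∈ repEvent d k n] = #S = N_n(η)` for the set `S` of spanning classes. -/
theorem sum_indicator_repEvent {d n : ℕ} {η : BondConfig (Site d)} {S : Set (Set (Site d))}
    (hS : ∀ A, A ∈ S ↔ ∃ u ∈ (↑(box d n) : Set (Site d)),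
      (∃ w ∈ (↑(innerBoundary (zdGraph d) (box d (2 * n))) : Set (Site d)),
        η ∈ openConnIn (↑(box d (2 * n)) : Set (Site d)) u w) ∧
      A = {v | η ∈ openConnIn (↑(box d (2 * n)) : Set (Site d)) u v}) :
    ∑ k ∈ Finset.range (box d n).card, (repEvent d k n).indicator (fun _ => (1 : ℝ)) η =
      (S.ncard : ℝ) := by
  have hP : (↑(box d n) : Set (Site d)).Finite := (box d n).finite_toSet
  have hle : S.ncard ≤ (box d n).card := by
    have := ncard_SC_le hS hP
    rwa [Set.ncard_coe_finset] at this
  have hk : ∀ k, η ∈ repEvent d k n ↔ k < S.ncard := fun k => by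
    rw [Nat.lt_iff_add_one_le]
    exact (succ_le_ncard_SC_iff
      (C := fun u => {v | η ∈ openConnIn (↑(box d (2 * n)) : Set (Site d)) u v}) hS
      (conn_symm _ η) (conn_trans _ η) hP k).symm
  calc ∑ k ∈ Finset.range (box d n).card, (repEvent d k n).indicator (fun _ => (1 : ℝ)) η
      = ∑ k ∈ Finset.range (box d n).card, if k < S.ncard then (1 : ℝ) else 0 :=
        Finset.sum_congr rfl fun k _ => by
          by_cases h : k < S.ncard
          · rw [if_pos h, Set.indicator_of_mem ((hk k).2 h)]
          · rw [if_neg h, Set.indicator_of_notMem (fun h' => h ((hk k).1 h'))]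
    _ = (((Finset.range (box d n).card).filter (· < S.ncard)).card : ℝ) := by
        rw [Finset.sum_boole]
    _ = S.ncard := by
        rw [show (Finset.range (box d n).card).filter (· < S.ncard) = Finset.range S.ncard from ?_,
          Finset.card_range]
        ext k
        simp only [Finset.mem_filter, Finset.mem_range]
        omega

end StubTypeTable

/-- **Stub `stub_typeTable`** of line `birth-merge-ledger` (crux stmt-CriticalPhenomena-4444): the
birth–merge type table of the monotone coupling.  For an edge `e` of `B(2n)` and any configuration
`ω`, with `ω⁺ = insert e ω`, `ω⁻ = ω \ {e}` and `N(η) = Σ_{k < #B(n)} 1[η ∈ repEvent d k n]` the number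
of clusters of the open graph induced on `B(2n)` meeting both `B(n)` and `∂ⁱⁿB(2n)`,
`N(ω⁺) - N(ω⁻) = 1[ω ∈ birth_e] - 1[ω ∈ merge_e]`, where `birth_e` says that (reading connections
in `ω⁻` inside `B(2n)`) one endpoint's cluster meets `B(n)` but not `∂` while the other's meets `∂`
but not `B(n)`, and `merge_e` says that the endpoints are not joined and both clusters meet `B(n)`
and `∂`. -/
theorem stub_typeTable :
    ∀ (d n : ℕ) (e : Sym2 (Site d)) (ω : BondConfig (Site d)), e ∈ edgesIn (zdGraph d) (box d (2 * n)) → (∑ k ∈ Finset.range (box d n).card, ((repEvent d k n).indicator (fun _ => (1 : ℝ)) (insert e ω) - (repEvent d k n).indicator (fun _ => (1 : ℝ)) (ω \ {e}))) = {ω' : BondConfig (Site d) | ∃ x y : Site d, e = s(x, y) ∧ (∃ v ∈ box d n, ω' \ {e} ∈ openConnIn (↑(box d (2 * n)) : Set (Site d)) x v) ∧ (∀ w ∈ innerBoundary (zdGraph d) (box d (2 * n)), ω' \ {e} ∉ openConnIn (↑(box d (2 * n)) : Set (Site d)) x w) ∧ (∃ w ∈ innerBoundary (zdGraph d) (box d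 (2 * n)), ω' \ {e} ∈ openConnIn (↑(box d (2 * n)) : Set (Site d)) y w) ∧ (∀ v ∈ box d n, ω' \ {e} ∉ openConnIn (↑(box d (2 * n)) : Set (Site d)) y v)}.indicator (fun _ => (1 : ℝ)) ω - {ω' : BondConfig (Site d) | ∃ x y : Site d, e = s(x, y) ∧ ω' \ {e} ∉ openConnIn (↑(box d (2 * n)) : Set (Site d)) x y ∧ (∃ v ∈ box d n, ω' \ {e} ∈ openConnIn (↑(box d (2 * n)) : Set (Site d)) x v) ∧ (∃ w ∈ innerBoundary (zdGraph d) (box d (2 * n)), ω' \ {e} ∈ openConnIn (↑(box d (2 * n)) : Set (Site d)) x w) ∧ (∃ v ∈ box d n, ω' \ {e} ∈ openConnIn (↑(box d (2 * n)) : Set (Site d)) y v) ∧ (∃ w ∈ innerBoundary (zdGraph d) (box d (2 * n)), ω' \ {e} ∈ openConnIn (↑(box d (2 * n)) : Set (Site d)) y w)}.indicator (fun _ => (1 : ℝ)) ω := by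
  intro d n e ω he
  induction e using Sym2.ind with
  | _ x₀ y₀ =>
  rw [mem_edgesIn_iff] at he
  obtain ⟨hadj, hmem⟩ := he
  have hne : x₀ ≠ y₀ := ((SimpleGraph.mem_edgeSet _).1 hadj).ne
  have hx : x₀ ∈ (↑(box d (2 * n)) : Set (Site d)) := Finset.mem_coe.2 (hmem x₀ (Sym2.mem_mk_left _ _))
  have hy : y₀ ∈ (↑(box d (2 * n)) : Set (Site d)) := Finset.mem_coe.2 (hmem y₀ (Sym2.mem_mk_right _ _))
  obtain ⟨S, hS⟩ := StubTypeTable.exists_SC d n (ω \ {s(x₀, y₀)})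
  obtain ⟨S', hS'⟩ := StubTypeTable.exists_SC d n (insert s(x₀, y₀) ω)
  classical
  rw [Finset.sum_sub_distrib, StubTypeTable.sum_indicator_repEvent hS',
    StubTypeTable.sum_indicator_repEvent hS, Set.indicator_apply, Set.indicator_apply]
  exact StubTypeTable.ncard_SC_glue_sub
    (C := fun u => {v | ω \ {s(x₀, y₀)} ∈ openConnIn (↑(box d (2 * n)) : Set (Site d)) u v})
    (C' := fun u => {v | insert s(x₀, y₀) ω ∈ openConnIn (↑(box d (2 * n)) : Set (Site d)) u v})
    hS (StubTypeTable.conn_symm _ _) (StubTypeTable.conn_trans _ _)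
    (StubTypeTable.conn_insert_iff rfl hne hx hy) hS' (box d n).finite_toSet (openConnIn_refl hx)

end Summit.CriticalPhenomena.PercolationContinuityZ3.Theorems.NonProliferation

end
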